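import Mathlib
import HarnessLib
import Summits.ValiantsHypothesis.ValiantsHypothesis.Theorems.LacunarySymmetroidMatrixDescartesProductPlusOneCrossingSeparation

/-!
# ValiantsHypothesis / LacunarySymmetroid — crux `MatrixDescartes` (stmt-ValiantsHypothesis-18050, V1),
# LINE (A) «product_plus_one», floor: zeros of the Euler polynomial INTERLACE with zeros of the log-Wronskian — the counting frame of AB5-1

Counting corollary of ✓ `…CrossingSeparation` (val-lit-p5 g14: between two zeros of `E = X·P′ − C ν·P` in a pole-free window the log-Wronskian
`N = W(P) = P·X(XP′)′ − (XP′)²` takes a negative AND a positive value).  By the intermediate value theorem `N` then VANISHES strictly between them, so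
inside every pole-free window `[u,v] ⊂ (0,∞)` the zeros of `E` and the zeros of `N` interlace:

* `card_le_card_add_one_of_between` — combinatorics: if between any two elements of a finite set `T ⊂ ℝ` lies an element of `R`, then `#T ≤ #R + 1`;
* `exists_wronskian_root_between_zeros` — between two zeros of `E` in a pole-free window `⊂ (0,∞)` there is a zero of `W(P)` (and `W(P) ≠ 0`);
* ★ `euler_roots_Icc_le_wronskian_roots_add_one` — `#{t ∈ [u,v] : E(t) = 0} ≤ #{w ∈ (u,v) : W(P)(w) = 0} + 1` for EVERY polynomial `P`, every level `ν`,
  every pole-free `[u,v] ⊂ (0,∞)`;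
* ★ `eulerNumerator_roots_Icc_le_wronskian_roots_add_one` — the same for the line's `eulerNumerator d a l₀` and `P = ∏_j Σ_l C a_{jl} X^{d_l}` (unfolded).

This is the kernel currency of val-idea-25 g3's AB5-1 / EB2 frame (`V_I ≤ π_I`, `π_I` = #components of `{N > 0} ∩ I`): any bound on the number of zeros of
the log-Wronskian in a window bounds the zeros of `E` there, by name.  HONEST FRAMING: counting frame only — it bounds nothing by itself (the EB2 family
is a CONJECTURE); NOT `OneChangeFloorK3`, not `stub_classRowK3`, not `stub_eulerBoundK3`, not `stub_polyLaw`, not `MatrixDescartes`, not Conjecture B;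
`VP ≠ VNP` is NOT proved.  No definitions, no named facts; Mathlib + ✓ `…CrossingSeparation` only.
-/

set_option linter.dupNamespace false

namespace Summit.ValiantsHypothesis.ValiantsHypothesis.Theorems.LacunarySymmetroidMatrixDescartes

namespace ProductPlusOne

open Polynomial Finset
open scoped BigOperators Topology

/-! ### §1 Combinatorics: interlacing finite sets -/

/-- **Interlacing count:** if strictly between any two elements of `T` there is an element of `R`, then `#T ≤ #R + 1`. [folklore] -/
theorem card_le_card_add_one_of_between (T R : Finset ℝ) (h : ∀ z ∈ T, ∀ z' ∈ T, z < z' → ∃ w ∈ R, z < w ∧ w < z') :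
    T.card ≤ R.card + 1 := by
  classical
  rcases T.eq_empty_or_nonempty with rfl | hne
  · simp
  set M := T.max' hne with hM
  -- the successor of a non-maximal element
  have hsucc : ∀ z ∈ T, z < M → ∃ s ∈ T, z < s ∧ ∀ w ∈ T, z < w → s ≤ w := by
    intro z hz hzM
    have hne' : (T.filter (fun w => z < w)).Nonempty := ⟨M, by rw [mem_filter]; exact ⟨Finset.max'_mem _ _, hzM⟩⟩
    refine ⟨(T.filter (fun w => z < w)).min' hne', ?_, ?_, fun w hw hzw => ?_⟩
    · exact (mem_filter.mp (Finset.min'_mem _ hne')).1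
    · exact (mem_filter.mp (Finset.min'_mem _ hne')).2
    · exact Finset.min'_le _ _ (by rw [mem_filter]; exact ⟨hw, hzw⟩)
  choose! nxt hnxtT hnxt_gt hnxt_le using hsucc
  -- a point of `R` between `z` and its successor
  have hpick : ∀ z ∈ T, z < M → ∃ w ∈ R, z < w ∧ w < nxt z :=
    fun z hz hzM => h z hz (nxt z) (hnxtT z hz hzM) (hnxt_gt z hz hzM)
  choose! pick hpickR hpick_gt hpick_lt using hpick
  set T' := T.filter (fun z => z < M) with hT'
  have hT'mem : ∀ z ∈ T', z ∈ T ∧ z < M := fun z hz => by simpa [hT'] using hz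
  have hmaps : Set.MapsTo pick T' R := fun z hz => by
    obtain ⟨hzT, hzM⟩ := hT'mem z hz
    exact hpickR z hzT hzM
  have hinj : Set.InjOn pick T' := by
    intro z₁ hz₁ z₂ hz₂ heq
    obtain ⟨h1T, h1M⟩ := hT'mem z₁ hz₁
    obtain ⟨h2T, h2M⟩ := hT'mem z₂ hz₂
    by_contra hne12
    rcases lt_or_gt_of_ne hne12 with h12 | h21
    · have hle : nxt z₁ ≤ z₂ := hnxt_le z₁ h1T h1M z₂ h2T h12
      have hlt₁ : pick z₁ < nxt z₁ := hpick_lt z₁ h1T h1M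
      have hlt₂ : z₂ < pick z₂ := hpick_gt z₂ h2T h2M
      exact absurd heq (by linarith : pick z₁ < pick z₂).ne
    · have hle : nxt z₂ ≤ z₁ := hnxt_le z₂ h2T h2M z₁ h1T h21
      have hlt₁ : pick z₂ < nxt z₂ := hpick_lt z₂ h2T h2M
      have hlt₂ : z₁ < pick z₁ := hpick_gt z₁ h1T h1M
      exact absurd heq (by linarith : pick z₂ < pick z₁).ne'
  have hT'le : T'.card ≤ R.card := Finset.card_le_card_of_injOn pick hmaps hinj
  have hTle : T.card ≤ T'.card + 1 := by
    have hsub : T ⊆ insert M T' := by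
      intro z hz
      rw [mem_insert]
      rcases eq_or_lt_of_le (Finset.le_max' T z hz) with hzM | hzM
      · exact Or.inl hzM
      · exact Or.inr (by rw [hT', mem_filter]; exact ⟨hz, hzM⟩)
    exact (card_le_card hsub).trans (Finset.card_insert_le _ _)
  omega

/-! ### §2 Zeros of `E` and zeros of `W(P)` interlace in a pole-free window -/

/-- **Between two zeros of `E = X·P′ − C ν·P` in a pole-free window `⊂ (0,∞)` the log-Wronskian `W(P)` VANISHES** (and is not the zero
polynomial): ✓ `exists_wronskian_neg_between_zeros` + ✓ `exists_wronskian_pos_between_zeros` + the intermediate value theorem. [this file's theorem] -/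
theorem exists_wronskian_root_between_zeros (P : ℝ[X]) (ν : ℝ) (hE : (X * derivative P - C ν * P : ℝ[X]) ≠ 0) {z z' : ℝ}
    (hz : 0 < z) (hzz' : z < z') (hP : ∀ t ∈ Set.Icc z z', P.eval t ≠ 0)
    (hEz : (X * derivative P - C ν * P : ℝ[X]).eval z = 0) (hEz' : (X * derivative P - C ν * P : ℝ[X]).eval z' = 0) :
    (P * (X * derivative (X * derivative P)) - (X * derivative P) ^ 2 : ℝ[X]) ≠ 0 ∧
      ∃ w ∈ Set.Ioo z z', (P * (X * derivative (X * derivative P)) - (X * derivative P) ^ 2 : ℝ[X]).eval w = 0 := by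
  obtain ⟨w₁, hw₁, hneg⟩ := exists_wronskian_neg_between_zeros P ν hE hz hzz' hP hEz hEz'
  obtain ⟨w₂, hw₂, hpos⟩ := exists_wronskian_pos_between_zeros P ν hE hz hzz' hP hEz hEz'
  refine ⟨fun h0 => ?_, ?_⟩
  · rw [h0, eval_zero] at hneg; exact lt_irrefl _ hneg
  have hcont : Continuous fun t => (P * (X * derivative (X * derivative P)) - (X * derivative P) ^ 2 : ℝ[X]).eval t :=
    Polynomial.continuous _
  rcases lt_or_gt_of_ne (show w₁ ≠ w₂ from fun h => by rw [h] at hneg; exact lt_asymm hneg hpos) with h12 | h21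
  · obtain ⟨w, hw, hw0⟩ := intermediate_value_Ioo h12.le hcont.continuousOn ⟨hneg, hpos⟩
    exact ⟨w, ⟨hw₁.1.trans hw.1, hw.2.trans hw₂.2⟩, hw0⟩
  · obtain ⟨w, hw, hw0⟩ := intermediate_value_Ioo' h21.le hcont.continuousOn ⟨hneg, hpos⟩
    exact ⟨w, ⟨hw₂.1.trans hw.1, hw.2.trans hw₁.2⟩, hw0⟩

/-- ★ **THE COUNTING FRAME (every polynomial `P`, every level `ν`, every pole-free window `[u,v] ⊂ (0,∞)`):**
`#{t ∈ [u,v] : E(t) = 0} ≤ #{w ∈ (u,v) : W(P)(w) = 0} + 1`. [this file's theorem; val-idea-25 AB5-1 in root currency] -/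
theorem euler_roots_Icc_le_wronskian_roots_add_one (P : ℝ[X]) (ν : ℝ) {u v : ℝ} (hu : 0 < u) (hP : ∀ t ∈ Set.Icc u v, P.eval t ≠ 0) :
    ((X * derivative P - C ν * P : ℝ[X]).roots.toFinset.filter (fun t => u ≤ t ∧ t ≤ v)).card
      ≤ ((P * (X * derivative (X * derivative P)) - (X * derivative P) ^ 2 : ℝ[X]).roots.toFinset.filter
          (fun w => u < w ∧ w < v)).card + 1 := by
  classical
  set E : ℝ[X] := X * derivative P - C ν * P with hEdef
  by_cases hE0 : E = 0
  · have : E.roots.toFinset.filter (fun t => u ≤ t ∧ t ≤ v) = ∅ := by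
      rw [hE0, roots_zero, Multiset.toFinset_zero, Finset.filter_empty]
    rw [this]; simp
  refine card_le_card_add_one_of_between _ _ fun z hz z' hz' hzz' => ?_
  rw [mem_filter, Multiset.mem_toFinset, mem_roots hE0] at hz hz'
  have hPI : ∀ t ∈ Set.Icc z z', P.eval t ≠ 0 := fun t ht => hP t ⟨hz.2.1.trans ht.1, ht.2.trans hz'.2.2⟩
  obtain ⟨hN0, w, hw, hw0⟩ := exists_wronskian_root_between_zeros P ν hE0 (hu.trans_le hz.2.1) hzz' hPI hz.1 hz'.1
  refine ⟨w, ?_, hw.1, hw.2⟩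
  rw [mem_filter, Multiset.mem_toFinset, mem_roots hN0]
  exact ⟨hw0, lt_of_le_of_lt hz.2.1 hw.1, lt_of_lt_of_le hw.2 hz'.2.2⟩

/-- ★ **The counting frame in the line's shape** (every format `(m, K)`, support `d`, table `a`, coupling `l₀`; `eulerNumerator d a l₀` and the rows
`Σ_l C a_{jl} X^{d_l}` unfolded, ✓ `eulerNumerator_eq_general`): on a pole-free `[u,v] ⊂ (0,∞)`,
`#{zeros of R in [u,v]} ≤ #{zeros of W(∏_j f_j) in (u,v)} + 1`. [this file's theorem] -/
theorem eulerNumerator_roots_Icc_le_wronskian_roots_add_one {m K : ℕ} (d : Fin K → ℕ) (a : Fin m → Fin K → ℝ) (l₀ : Fin K)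
    {u v : ℝ} (hu : 0 < u) (hP : ∀ t ∈ Set.Icc u v, (∏ j, ∑ l, C (a j l) * X ^ (d l) : ℝ[X]).eval t ≠ 0) :
    ((∑ j, (∑ l, C (a j l * ((d l : ℝ) - d l₀)) * X ^ (d l)) * ∏ i ∈ Finset.univ.erase j, (∑ l, C (a i l) * X ^ (d l))
        : ℝ[X]).roots.toFinset.filter (fun t => u ≤ t ∧ t ≤ v)).card
      ≤ (((∏ j, ∑ l, C (a j l) * X ^ (d l) : ℝ[X]) * (X * derivative (X * derivative (∏ j, ∑ l, C (a j l) * X ^ (d l) : ℝ[X])))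
            - (X * derivative (∏ j, ∑ l, C (a j l) * X ^ (d l) : ℝ[X])) ^ 2).roots.toFinset.filter
          (fun w => u < w ∧ w < v)).card + 1 := by
  rw [eulerNumerator_eq_general]
  exact euler_roots_Icc_le_wronskian_roots_add_one _ _ hu hP

end ProductPlusOne

end Summit.ValiantsHypothesis.ValiantsHypothesis.Theorems.LacunarySymmetroidMatrixDescartes
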